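import Summits.ResolutionOfSingularities.ResolutionOfSingularities.Theorems.HomologicalConductorNoZenoRContractedSections
import Literature.AlgebraicGeometry.Modules.IdealMulMaps
import Literature.AlgebraicGeometry.Modules.SectionsExact
import HarnessLib

/-!
# Crux `NoZenoR` (stmt-ResolutionOfSingularities-19943) — the multiplication map
# `Ψₙ : (𝔪ⁿ𝒪_X)^{⊕s} → 𝔪ⁿ⁺¹𝒪_X`, `(u_i) ↦ Σ t_i u_i`, IS AN EPIMORPHISM of `𝒪_X`-modules (road (R1′), step (a))

Route `ResolutionOfSingularities/HomologicalConductor` (cell decomp-res, hand leafhand-res-homologicalconduct-22 g0).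
OURS: AI-written, weaker than expert review; nothing here is a statement of the manuscript under review (Hironaka 2017).
SUPPORT level, counted 0.  Def-free (the map is produced existentially), fact-free.

Road (R1′) to the residual of `Lipman1969_8_1` (memo of this hand; `…ContractedSections.isIntegrallyClosed_stalk_affineBlowup_of_sections_generate`):
Γ-generation `Γ(X, 𝔪ⁿ⁺¹𝒪_X) = Σ tᵢ·Γ(X, 𝔪ⁿ𝒪_X)` follows from `Ȟ¹(ker Ψₙ) = 0` for the sheaf epimorphism `Ψₙ`.  This
file PROVES step (a): for `π : X → Spec S`, an ideal `I = (t₁,…,t_s)` of `S` and any ideal `J`, there is a morphism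
`Ψ : ⨁_{i} (J𝒪_X) ⟶ (IJ)𝒪_X` of `𝒪_X`-modules (`J𝒪_X = idealMul 𝒪_X (ofIdealTop (J·Γ(X,𝒪_X)))`, tree
`Literature/AlgebraicGeometry/Modules/IdealMul`) whose `i`-th component is multiplication by `tᵢ`, and `Ψ` is an
EPIMORPHISM (surjective on every affine open: `(IJ)(V) = Σ tᵢ|_V · J(V)`).

* `isIdealMulSection_globalScalar_idealMulι` — multiplication by `algebraMapΓ π a`, `a ∈ I`, maps sections of `J𝒪_X` to
  sections of `(IJ)𝒪_X`;
* `exists_epi_mulMap` — **the epimorphism `Ψ : ⨁ᵢ J𝒪_X ↠ (IJ)𝒪_X`, `(uᵢ) ↦ Σ tᵢ uᵢ`** (with its defining identities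
  `ιᵢ ≫ Ψ ≫ ι_{IJ} = ι_J ≫ (tᵢ ·)`); the case `I = 𝔪`, `J = 𝔪ⁿ` is `Ψₙ`.

What remains for (R1′): `Ȟ¹(ker Ψₙ) = 0` (the kernel is generated by the global sections `t^β(t_jε_i − t_iε_j)`,
`…KoszulSyzygies`; right-exactness `cechMapH1_surjective_of_isResolution_of_coh`), then
`app_top_surjective_of_shortExact_of_subsingleton_cechMH1` gives the Γ-generation.

No crux, kill test or summit statement is proved here; resolution in positive characteristic is NOT proved.

References: J. Lipman, Publ. Math. IHÉS 36 (1969), Theorem (7.2), Lemma (7.3) (pp. 209–211) [`Lipman1969`];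
U. Görtz, T. Wedhorn, *Algebraic Geometry I* (2020), (7.3.6), Prop. 7.14 [`GortzWedhorn2020`].
-/

noncomputable section

-- single-problem summit: the doubled namespace component `ResolutionOfSingularities` is forced
set_option linter.dupNamespace false
-- `TopCat.Presheaf`/`Scheme.Modules` are not reducible (as in Mathlib's `AlgebraicGeometry/Modules`).
set_option backward.isDefEq.respectTransparency false

open CategoryTheory CategoryTheory.Limits AlgebraicGeometry TopologicalSpace Opposite IsLocalRing
open Literature.AlgebraicGeometry.Morphisms Literature.AlgebraicGeometry.Modules
open Literature.AlgebraicGeometry.Resolution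
open Literature.AlgebraicGeometry.Motives (Scheme.Modules.Hom.app_map_apply)

namespace Summit.ResolutionOfSingularities.ResolutionOfSingularities.Theorems.NoZeno.QuadraticTransform

variable {S : Type} [CommRing S] {X : Scheme.{0}} (π : X ⟶ Spec (.of S))

/-- The restriction to an affine open `V` of `algebraMapΓ π a`, `a ∈ I`, lies in the ideal `(I𝒪_X)(V)`. [folklore] -/
theorem map_algebraMapΓ_mem_ideal (I : Ideal S) {a : S} (ha : a ∈ I) (V : X.affineOpens) :
    X.presheaf.map (homOfLE (le_top : (V : X.Opens) ≤ ⊤)).op (algebraMapΓ π a) ∈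
      (Scheme.IdealSheafData.ofIdealTop (I.map (algebraMapΓ π))).ideal V := by
  rw [Scheme.IdealSheafData.ofIdealTop_ideal]
  exact Ideal.mem_map_of_mem _ (Ideal.mem_map_of_mem _ ha)

/-- **Multiplication by `a ∈ I` maps `J𝒪_X` into `(IJ)𝒪_X`**: the sections of `(a ·) ∘ ι_J` are `(IJ)`-product sections.
[cite: GortzWedhorn2020, (7.3.6), Prop. 7.14] -/
theorem isIdealMulSection_globalScalar_idealMulι (I J : Ideal S) {a : S} (ha : a ∈ I) (U : X.Opens)
    (m : Γ(idealMul (unitModule X) (Scheme.IdealSheafData.ofIdealTop (J.map (algebraMapΓ π))), U)) :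
    IsIdealMulSection (unitModule X) (Scheme.IdealSheafData.ofIdealTop ((I * J).map (algebraMapΓ π))) U
      ((globalScalar (unitModule X) (algebraMapΓ π a)).app U
        ((idealMulι (unitModule X) (Scheme.IdealSheafData.ofIdealTop (J.map (algebraMapΓ π)))).app U m)) := by
  intro x hx
  obtain ⟨V, hVU, hxV, hmem⟩ :=
    isIdealMulSection_idealMulι_app (unitModule X) (Scheme.IdealSheafData.ofIdealTop (J.map (algebraMapΓ π))) U m x hx
  refine ⟨V, hVU, hxV, ?_⟩
  rw [mem_ideal_smul_top_unitModule_iff] at hmem ⊢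
  rw [← Scheme.Modules.Hom.app_map_apply, globalScalar_app_apply]
  change X.presheaf.map (homOfLE (le_top : (V : X.Opens) ≤ ⊤)).op (algebraMapΓ π a) *
      (show Γ(X, V) from (unitModule X).presheaf.map (homOfLE hVU).op
        ((idealMulι (unitModule X) (Scheme.IdealSheafData.ofIdealTop (J.map (algebraMapΓ π)))).app U m)) ∈ _
  rw [ofIdealTop_map_mul_ideal]
  exact Ideal.mul_mem_mul (map_algebraMapΓ_mem_ideal π I ha V) hmem

/-- **The multiplication map `Ψ : ⨁ᵢ J𝒪_X ↠ (IJ)𝒪_X`, `(uᵢ) ↦ Σ tᵢ uᵢ`, exists and is an epimorphism** for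
`I = (t₁,…,t_s)`: its components are the lifts of `ι_J ≫ (tᵢ ·)` to `(IJ)𝒪_X`, and on every affine open `V` it is
onto because `(IJ)(V) = I(V)·J(V) = Σᵢ tᵢ|_V · J(V)`.  (Road (R1′) step (a); for `I = 𝔪`, `J = 𝔪ⁿ` this is
`Ψₙ : (𝔪ⁿ𝒪_X)^{⊕s} ↠ 𝔪ⁿ⁺¹𝒪_X`.) [cite: Lipman1969, Lemma (7.3) (p. 210); GortzWedhorn2020, Prop. 7.14] -/
theorem exists_epi_mulMap [HasFiniteBiproducts X.Modules] {s : ℕ} (t : Fin s → S) (J : Ideal S) :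
    ∃ Ψ : (⨁ fun _ : Fin s => idealMul (unitModule X) (Scheme.IdealSheafData.ofIdealTop (J.map (algebraMapΓ π)))) ⟶
        idealMul (unitModule X) (Scheme.IdealSheafData.ofIdealTop ((Ideal.span (Set.range t) * J).map (algebraMapΓ π))),
      (∀ i, biproduct.ι _ i ≫ Ψ ≫ idealMulι (unitModule X) _ =
        idealMulι (unitModule X) _ ≫ globalScalar (unitModule X) (algebraMapΓ π (t i))) ∧ Epi Ψ := by
  classical
  set I : Ideal S := Ideal.span (Set.range t) with hI
  set JJ := Scheme.IdealSheafData.ofIdealTop (J.map (algebraMapΓ π)) with hJJ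
  set KK := Scheme.IdealSheafData.ofIdealTop ((I * J).map (algebraMapΓ π)) with hKK
  have hti : ∀ i, t i ∈ I := fun i => Ideal.subset_span ⟨i, rfl⟩
  -- the components `μᵢ : J𝒪_X ⟶ (IJ)𝒪_X`
  let μ : Fin s → (idealMul (unitModule X) JJ ⟶ idealMul (unitModule X) KK) := fun i =>
    idealMulLift (idealMulι (unitModule X) JJ ≫ globalScalar (unitModule X) (algebraMapΓ π (t i)))
      (fun U m => by
        rw [Scheme.Modules.Hom.comp_app, CategoryTheory.comp_apply]
        exact isIdealMulSection_globalScalar_idealMulι π I J (hti i) U m)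
  have hμ : ∀ i, μ i ≫ idealMulι (unitModule X) KK =
      idealMulι (unitModule X) JJ ≫ globalScalar (unitModule X) (algebraMapΓ π (t i)) := fun i => idealMulLift_ι _ _
  let Ψ : (⨁ fun _ : Fin s => idealMul (unitModule X) JJ) ⟶ idealMul (unitModule X) KK := biproduct.desc μ
  have hΨ : ∀ i, biproduct.ι _ i ≫ Ψ ≫ idealMulι (unitModule X) KK =
      idealMulι (unitModule X) JJ ≫ globalScalar (unitModule X) (algebraMapΓ π (t i)) := fun i => by
    rw [biproduct.ι_desc_assoc, hμ]
  refine ⟨Ψ, hΨ, ?_⟩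
  -- surjective on affine opens
  refine epi_of_surjective_app_of_isAffineOpen _ fun V hV y => ?_
  -- the section condition on the `i`-th summand, read on sections over `V`
  have hcomp : ∀ (i : Fin s) (m : Γ(idealMul (unitModule X) JJ, V)),
      (idealMulι (unitModule X) KK).app V (Ψ.app V ((biproduct.ι (fun _ : Fin s => idealMul (unitModule X) JJ) i).app V m)) =
        X.presheaf.map (homOfLE (le_top : V ≤ ⊤)).op (algebraMapΓ π (t i)) •
          (idealMulι (unitModule X) JJ).app V m := by
    intro i m
    have h := congrArg (fun φ => φ.app V m) (hΨ i)
    simp only [Scheme.Modules.Hom.comp_app, CategoryTheory.comp_apply, globalScalar_app_apply] at h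
    exact h
  -- `ι y ∈ (IJ)(V) = I(V) · J(V)`; induct over this product
  have hy : (show Γ(X, V) from (idealMulι (unitModule X) KK).app V y) ∈
      (Scheme.IdealSheafData.ofIdealTop (I.map (algebraMapΓ π))).ideal ⟨V, hV⟩ * JJ.ideal ⟨V, hV⟩ := by
    have h := idealMulι_app_mem (M := unitModule X) (J := KK) IsAffineLocalizing.unit hV y
    rw [mem_ideal_smul_top_unitModule_iff] at h
    have e : KK.ideal ⟨V, hV⟩ = (Scheme.IdealSheafData.ofIdealTop (I.map (algebraMapΓ π))).ideal ⟨V, hV⟩ *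
        JJ.ideal ⟨V, hV⟩ := ofIdealTop_map_mul_ideal π I J ⟨V, hV⟩
    rwa [e] at h
  -- every element of `I(V)·J(V)` has a preimage under `(Ψ ≫ ι).app V`
  have key : ∀ z ∈ (Scheme.IdealSheafData.ofIdealTop (I.map (algebraMapΓ π))).ideal ⟨V, hV⟩ * JJ.ideal ⟨V, hV⟩,
      ∃ w : Γ((⨁ fun _ : Fin s => idealMul (unitModule X) JJ), V),
        (show Γ(X, V) from (idealMulι (unitModule X) KK).app V (Ψ.app V w)) = z := by
    intro z hz
    refine Submodule.mul_induction_on hz (fun r hr c hc => ?_) (fun z₁ z₂ ⟨w₁, hw₁⟩ ⟨w₂, hw₂⟩ => ?_)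
    · -- `r ∈ I(V) = span (tᵢ|_V)`: `r = Σ bᵢ tᵢ|_V`
      have eI : (Scheme.IdealSheafData.ofIdealTop (I.map (algebraMapΓ π))).ideal ⟨V, hV⟩ =
          Ideal.span (Set.range fun i => X.presheaf.map (homOfLE (le_top : V ≤ ⊤)).op (algebraMapΓ π (t i))) :=
        ofIdealTop_map_span_range_ideal π t ⟨V, hV⟩
      rw [eI] at hr
      obtain ⟨b, hb⟩ := Ideal.mem_span_range_iff_exists_fun.mp hr
      -- sections `mᵢ` of `J𝒪_X` over `V` with `ι mᵢ = bᵢ c`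
      have hsec : ∀ i, ∃ m : Γ(idealMul (unitModule X) JJ, V),
          (idealMulι (unitModule X) JJ).app V m = (show Γ(unitModule X, V) from (b i * c : Γ(X, V))) := fun i =>
        by
          have hbc : (b i * c : Γ(X, V)) ∈ JJ.ideal ⟨V, hV⟩ := Ideal.mul_mem_left (JJ.ideal ⟨V, hV⟩) (b i) hc
          exact exists_idealMulι_app_eq (unitModule X) JJ _
            (isIdealMulSection_of_mem hV ((mem_ideal_smul_top_unitModule_iff JJ ⟨V, hV⟩ _).mpr hbc))
      choose m hm using hsec
      refine ⟨∑ i, (biproduct.ι (fun _ : Fin s => idealMul (unitModule X) JJ) i).app V (m i), ?_⟩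
      rw [map_sum, map_sum, ← hb, Finset.sum_mul]
      change (∑ i, (idealMulι (unitModule X) KK).app V (Ψ.app V ((biproduct.ι (fun _ : Fin s => idealMul (unitModule X) JJ) i).app V (m i))) : Γ(X, V)) = _
      refine Finset.sum_congr rfl fun i _ => ?_
      rw [hcomp i, hm i]
      change X.presheaf.map (homOfLE (le_top : V ≤ ⊤)).op (algebraMapΓ π (t i)) * (b i * c) = _
      ring
    · exact ⟨w₁ + w₂, by rw [map_add, map_add, ← hw₁, ← hw₂]⟩
  obtain ⟨w, hw⟩ := key _ hy
  exact ⟨w, idealMulι_app_injective (unitModule X) KK V hw⟩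

end Summit.ResolutionOfSingularities.ResolutionOfSingularities.Theorems.NoZeno.QuadraticTransform

end
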